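import Summits.QuantumFields.YangMills.Theorems.LuscherReductionRunningReductionBOHandoverLabels
import Summits.QuantumFields.YangMills.Theorems.LuscherReductionTwistedTraceScalingTwoLoopFlow
import HarnessLib

/-!
# FLOW JUNCTION for crux `TwistedTraceScaling` (stmt-QuantumFields-20203), line «twolattice», stub TOWER-E1: what a TWO-LOOP discrete renormalisation-group
# flow with summable remainder delivers at the box scale, against the tree's two-loop label `invRunningCoupling` (kernel-checked arithmetic; part 2)

Route `LuscherReduction` (owner ym-beyond-p1), LEAD ym-lead-20203-twolattice g1, RG plan `RG-PLAN-20203-towerE1.md` (evidence #42 on stmt-QuantumFields-20203) §2 (S2)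
/ §3 (FLOW).  Part 1 (`…TwistedTraceScalingTwoLoopFlow`) proved, for abstract real sequences, the endpoint arithmetic of the two-loop discrete flow

  `x_j − x_{j+1} = a + κ·a/x_j + e_j`,  `Σ_{j<K} |e_j| ≤ R`,  floor `x_j ≥ m ≥ 1`,  `a + κa + R ≤ m/2`   (TL)

(`twoLoopFlow_endpoint : |x_K − (x_0 − aK − κ log(x_0/x_K))| ≤ κ·C₂ + R`).  THIS FILE specialises to the tree's constants `a = 2b₀ log M`, `κ = b₁/b₀`
(`b₀ = 11/(24π²)`, `b₁ = 17/(96π⁴)`, `Theorems/FemtoTransferGap.lean`), the bare datum `x_0 = β/2` (tree normalisation `β = β_W/2`, `g₀² = 2/β`) and an E1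
tower `|log L − log b − K log M| ≤ 1`, and proves the junction with the label `invRunningCoupling β L = β/2 − 2b₀ log L + (b₁/b₀) log(2b₀/β)`
(`BOHandover.invRunningCoupling_eq`):

* §4 ★ `flowJunction` — `|x_K − invRunningCoupling β L − (b₁/b₀) log(x_K/b₀)| ≤ (b₁/b₀)·C₂ + R + 2b₀(|log b| + 1)`, uniformly in `K`, `β`, `L`: the label's
  two-loop term `(b₁/b₀) log(2b₀/β)` — with `log β ≈ log log L → ∞` as `L → ∞` at fixed depth — CANCELS against the flow's two-loop sum (`log_cancel`:
  `log(2b₀/β) + log((β/2)/x_K) + log(x_K/b₀) = 0`); what is left is `O(1) + (b₁/b₀) log x_K`.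
* §4b `flowJunction_oneLoop` (contrast) — with `κ = 0` (a ONE-loop flow with bounded remainder) the endpoint misses the label by exactly the label's
  two-loop term: `|x_K − invRunningCoupling β L − (b₁/b₀) log(β/(2b₀))| ≤ R + 2b₀(|log b| + 1)` — unbounded along the window as `L → ∞` at fixed depth.
* §5 ★ `ratio_near_one_of_abs_sub_le_log` (real-variable: `|x − y − κ log(x/c)| ≤ C`, `x ≥ 1` ⇒ `x/y → 1` as `y → ∞`, quantitatively) and
  ★ `flowJunction_ratio` — for every `δ > 0` there is `Y(M, m, R, b, δ)` such that `invRunningCoupling β L ≥ Y` (deep in the femto window) forces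
  `|x_K · luscherLambda β L ^ 3 − 1| ≤ δ`.  By (S2) of the plan (leading order tolerates `1/g_K² = Λ⁻³(1 + o(1))`) this is ALL the leading-order femto trace
  law asks of the FLOW module: no Λ-parameter matching, no scheme constant — but the `κ = b₁/b₀` term of (TL) IS needed (with `κ = 0` the junction would carry
  the unbounded `(b₁/b₀) log β`), and a one-loop SANDWICH such as [Balaban1987RG1] Thm 2 (0.31) (typed `B12.Thm2Printed`, stated without proof) locates `x_K`
  only within a window of width `∝ K log M → ∞`.

HONEST FRAMING: elementary real analysis about hypothetical sequences; the existence of Bałaban's effective couplings satisfying (TL) on the femto tori is the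
OPEN FLOW module (XXL, not in print); femto rung R2b1 of a CONDITIONAL reduction route; nothing here is a claim about Yang–Mills, a gap, or Clay.
No definitions, no new named facts.  Cone-free imports (`…BOHandoverLabels`, part 1).
-/

set_option autoImplicit false

noncomputable section

open Real
open scoped BigOperators

namespace Summit.QuantumFields.YangMills.Theorems.FemtoTransferGap.TwoLattice

open Summit.QuantumFields.YangMills.Theorems.FemtoTransferGap

namespace TowerFlow

/-! ## §4 ★ Junction with the tree's two-loop label -/

/-- The three logarithms of the junction cancel: `log(2b₀/β) + log((β/2)/x) + log(x/b₀) = 0` (`β, x > 0`). [folklore] -/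
theorem log_cancel {β x : ℝ} (hβ : 0 < β) (hx : 0 < x) :
    Real.log (2 * b0 / β) + Real.log (β / 2 / x) + Real.log (x / b0) = 0 := by
  have hb0 : 0 < b0 := by unfold b0; positivity
  rw [Real.log_div (by positivity) hβ.ne', Real.log_div (by positivity) hx.ne', Real.log_div hβ.ne' (by norm_num),
    Real.log_div hx.ne' hb0.ne', Real.log_mul (by norm_num) hb0.ne']
  ring

/-- ★ §4 **FLOW JUNCTION.**  A two-loop discrete flow (TL) with `a = 2b₀ log M`, `κ = b₁/b₀`, bare datum `x_0 = β/2`, summable remainder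
`Σ|e_j| ≤ R`, floor `x_j ≥ m ≥ 1` (`a + κa + R ≤ m/2`), run for `K` steps along an E1 tower (`|log L − log b − K log M| ≤ 1`), ends at
`x_K = invRunningCoupling β L + (b₁/b₀) log(x_K/b₀) + O(1)`: the label's two-loop term `(b₁/b₀) log(2b₀/β)` cancels against the flow's
two-loop sum (`log_cancel`), uniformly in `K`, `β`, `L`. [cite: Rivasseau1991, Lemma II.5.4] [cite: LuscherMunster1984, §2] -/
theorem flowJunction {x e : ℕ → ℝ} {M m R β : ℝ} {K b L : ℕ} (hM : 1 < M) (hm : 1 ≤ m)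
    (hR : ∑ j ∈ Finset.range K, |e j| ≤ R)
    (hsmall : 2 * b0 * Real.log M + (b1 / b0) * (2 * b0 * Real.log M) + R ≤ m / 2)
    (hx : ∀ j, j ≤ K → m ≤ x j) (hx0 : x 0 = β / 2)
    (hflow : ∀ j, j < K → x j - x (j + 1) = 2 * b0 * Real.log M + (b1 / b0) * (2 * b0 * Real.log M) / x j + e j)
    (htower : |Real.log (L : ℝ) - Real.log (b : ℝ) - K * Real.log M| ≤ 1) :
    |x K - invRunningCoupling β L - (b1 / b0) * Real.log (x K / b0)| ≤
      (b1 / b0) * (((b1 / b0) * (2 * b0 * Real.log M) + m ^ 2 / 2) * ((1 / m + 2 * R / m ^ 2) / (2 * b0 * Real.log M)) + R / m)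
        + R + 2 * b0 * (|Real.log (b : ℝ)| + 1) := by
  have hb0 : 0 < b0 := by unfold b0; positivity
  have hb1 : 0 < b1 := by unfold b1; positivity
  have hκ : 0 ≤ b1 / b0 := (div_pos hb1 hb0).le
  have ha : 0 < 2 * b0 * Real.log M := by
    have : 0 < Real.log M := Real.log_pos hM
    positivity
  have hend := twoLoopFlow_endpoint ha hκ hm hR hsmall hx hflow
  have hmpos : 0 < m := by linarith
  have hxK : 0 < x K := lt_of_lt_of_le hmpos (hx K le_rfl)
  have hβ : 0 < β := by
    have := hx 0 (Nat.zero_le _); rw [hx0] at this; linarith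
  rw [hx0] at hend
  have hcancel := log_cancel hβ hxK
  rw [BOHandover.invRunningCoupling_eq]
  set C₂ : ℝ := ((b1 / b0) * (2 * b0 * Real.log M) + m ^ 2 / 2) * ((1 / m + 2 * R / m ^ 2) / (2 * b0 * Real.log M)) + R / m
  -- split off the endpoint estimate; the rest is `2b₀ (log L − K log M) = 2b₀ (log b + θ)`
  have hsplit : x K - (β / 2 - 2 * b0 * Real.log (L : ℝ) + b1 / b0 * Real.log (2 * b0 / β)) - b1 / b0 * Real.log (x K / b0)
      = (x K - (β / 2 - 2 * b0 * Real.log M * K - b1 / b0 * Real.log (β / 2 / x K)))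
        + 2 * b0 * (Real.log (L : ℝ) - K * Real.log M)
        - b1 / b0 * (Real.log (2 * b0 / β) + Real.log (β / 2 / x K) + Real.log (x K / b0)) := by ring
  rw [hsplit, hcancel, mul_zero, sub_zero]
  have hθ : |2 * b0 * (Real.log (L : ℝ) - K * Real.log M)| ≤ 2 * b0 * (|Real.log (b : ℝ)| + 1) := by
    rw [abs_mul, abs_of_pos (by positivity : (0 : ℝ) < 2 * b0)]
    refine mul_le_mul_of_nonneg_left ?_ (by positivity)
    have h1 : Real.log (L : ℝ) - K * Real.log M = (Real.log (L : ℝ) - Real.log (b : ℝ) - K * Real.log M) + Real.log (b : ℝ) := by ring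
    rw [h1]
    calc |Real.log (L : ℝ) - Real.log (b : ℝ) - K * Real.log M + Real.log (b : ℝ)|
        ≤ |Real.log (L : ℝ) - Real.log (b : ℝ) - K * Real.log M| + |Real.log (b : ℝ)| := abs_add_le _ _
      _ ≤ |Real.log (b : ℝ)| + 1 := by linarith
  calc |x K - (β / 2 - 2 * b0 * Real.log M * K - b1 / b0 * Real.log (β / 2 / x K)) + 2 * b0 * (Real.log (L : ℝ) - K * Real.log M)|
      ≤ |x K - (β / 2 - 2 * b0 * Real.log M * K - b1 / b0 * Real.log (β / 2 / x K))| + |2 * b0 * (Real.log (L : ℝ) - K * Real.log M)| :=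
        abs_add_le _ _
    _ ≤ ((b1 / b0) * C₂ + R) + 2 * b0 * (|Real.log (b : ℝ)| + 1) := add_le_add hend hθ

/-- §4b (contrast) **A ONE-LOOP flow does NOT meet the label.**  With `κ = 0` in (TL) (decrements `2b₀ log M + e_j`, `Σ|e_j| ≤ R`) the endpoint
misses the label by the label's own two-loop term: `|x_K − invRunningCoupling β L − (b₁/b₀) log(β/(2b₀))| ≤ R + 2b₀(|log b| + 1)`.  Along the femto
window at fixed depth `log β ≈ log log L → ∞`, so `x_K·Λ³ ↛ 1` uniformly in `L`: the `b₁` term of the flow is load-bearing for the leading-order femto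
law (RG plan (S2)(b)). [cite: LuscherMunster1984, §2] -/
theorem flowJunction_oneLoop {x e : ℕ → ℝ} {M m R β : ℝ} {K b L : ℕ} (hM : 1 < M) (hm : 1 ≤ m)
    (hR : ∑ j ∈ Finset.range K, |e j| ≤ R)
    (hsmall : 2 * b0 * Real.log M + 0 * (2 * b0 * Real.log M) + R ≤ m / 2)
    (hx : ∀ j, j ≤ K → m ≤ x j) (hx0 : x 0 = β / 2)
    (hflow : ∀ j, j < K → x j - x (j + 1) = 2 * b0 * Real.log M + 0 * (2 * b0 * Real.log M) / x j + e j)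
    (htower : |Real.log (L : ℝ) - Real.log (b : ℝ) - K * Real.log M| ≤ 1) :
    |x K - invRunningCoupling β L - (b1 / b0) * Real.log (β / (2 * b0))| ≤ R + 2 * b0 * (|Real.log (b : ℝ)| + 1) := by
  have hb0 : 0 < b0 := by unfold b0; positivity
  have ha : 0 < 2 * b0 * Real.log M := by
    have : 0 < Real.log M := Real.log_pos hM
    positivity
  have hend := twoLoopFlow_endpoint ha le_rfl hm hR hsmall hx hflow
  rw [hx0] at hend
  have hmpos : 0 < m := by linarith
  have hβ : 0 < β := by
    have := hx 0 (Nat.zero_le _); rw [hx0] at this; linarith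
  rw [BOHandover.invRunningCoupling_eq]
  have hlog : Real.log (β / (2 * b0)) = -Real.log (2 * b0 / β) := by
    rw [← Real.log_inv, inv_div]
  have hsplit : x K - (β / 2 - 2 * b0 * Real.log (L : ℝ) + b1 / b0 * Real.log (2 * b0 / β)) - b1 / b0 * Real.log (β / (2 * b0))
      = (x K - (β / 2 - 2 * b0 * Real.log M * K - 0 * Real.log (β / 2 / x K))) + 2 * b0 * (Real.log (L : ℝ) - K * Real.log M) := by
    rw [hlog]; ring
  rw [hsplit]
  have hθ : |2 * b0 * (Real.log (L : ℝ) - K * Real.log M)| ≤ 2 * b0 * (|Real.log (b : ℝ)| + 1) := by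
    rw [abs_mul, abs_of_pos (by positivity : (0 : ℝ) < 2 * b0)]
    refine mul_le_mul_of_nonneg_left ?_ (by positivity)
    have h1 : Real.log (L : ℝ) - K * Real.log M = (Real.log (L : ℝ) - Real.log (b : ℝ) - K * Real.log M) + Real.log (b : ℝ) := by ring
    rw [h1]
    calc |Real.log (L : ℝ) - Real.log (b : ℝ) - K * Real.log M + Real.log (b : ℝ)|
        ≤ |Real.log (L : ℝ) - Real.log (b : ℝ) - K * Real.log M| + |Real.log (b : ℝ)| := abs_add_le _ _
      _ ≤ |Real.log (b : ℝ)| + 1 := by linarith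
  calc |x K - (β / 2 - 2 * b0 * Real.log M * K - 0 * Real.log (β / 2 / x K)) + 2 * b0 * (Real.log (L : ℝ) - K * Real.log M)|
      ≤ |x K - (β / 2 - 2 * b0 * Real.log M * K - 0 * Real.log (β / 2 / x K))| + |2 * b0 * (Real.log (L : ℝ) - K * Real.log M)| := abs_add_le _ _
    _ ≤ (0 * _ + R) + 2 * b0 * (|Real.log (b : ℝ)| + 1) := add_le_add hend hθ
    _ = R + 2 * b0 * (|Real.log (b : ℝ)| + 1) := by ring

/-! ## §5 ★ Hence the last effective coupling IS the femto parameter: `x_K · Λ³ → 1` -/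

/-- Real-variable lemma: if `|x − y − κ log(x/c)| ≤ C` with `x ≥ 1`, `κ ≥ 0`, `c > 0`, then `x/y → 1` as `y → ∞`, quantitatively:
for every `δ > 0` there is `Y > 0` (depending on `κ, c, C, δ` only) with `|x/y − 1| ≤ δ` whenever `y ≥ Y`. [folklore] -/
theorem ratio_near_one_of_abs_sub_le_log {κ c C : ℝ} (hκ : 0 ≤ κ) (hc : 0 < c) (hC : 0 ≤ C) {δ : ℝ} (hδ : 0 < δ) :
    ∃ Y : ℝ, 0 < Y ∧ ∀ x y : ℝ, 1 ≤ x → Y ≤ y → |x - y - κ * Real.log (x / c)| ≤ C → |x / y - 1| ≤ δ := by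
  -- work with `δ' = min δ 1`, slope budget `δ'/4` bought with `t = max 1 (4κ/δ')`
  set δ' : ℝ := min δ 1 with hδ'
  have hδ'pos : 0 < δ' := lt_min hδ one_pos
  have hδ'le : δ' ≤ δ := min_le_left _ _
  have hδ'1 : δ' ≤ 1 := min_le_right _ _
  set t : ℝ := max 1 (4 * κ / δ') with ht
  have ht1 : 1 ≤ t := le_max_left _ _
  have htpos : 0 < t := lt_of_lt_of_le one_pos ht1
  have hκt : κ / t ≤ δ' / 4 := by
    rw [div_le_iff₀ htpos]
    have : 4 * κ / δ' ≤ t := le_max_right _ _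
    rw [div_le_iff₀ hδ'pos] at this
    linarith
  set D : ℝ := C + κ * |Real.log c| + κ * Real.log t with hD
  have hlogt : 0 ≤ Real.log t := Real.log_nonneg ht1
  have hD0 : 0 ≤ D := by positivity
  refine ⟨max 1 (4 * D / δ'), lt_of_lt_of_le one_pos (le_max_left _ _), ?_⟩
  intro x y hx1 hy hxy
  have hy1 : 1 ≤ y := (le_max_left _ _).trans hy
  have hypos : 0 < y := by linarith
  have hDy : D ≤ δ' / 4 * y := by
    have : 4 * D / δ' ≤ y := (le_max_right _ _).trans hy
    rw [div_le_iff₀ hδ'pos] at this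
    linarith
  have hxpos : 0 < x := by linarith
  -- `κ |log(x/c)| ≤ κ log t + (κ/t) x + κ |log c|`, using `log x ≤ log t + x/t − 1`
  have hlogx : Real.log x ≤ Real.log t + x / t := by
    have h := Real.log_le_sub_one_of_pos (div_pos hxpos htpos)
    rw [Real.log_div hxpos.ne' htpos.ne'] at h
    linarith
  have hlogx0 : 0 ≤ Real.log x := Real.log_nonneg hx1
  have habslog : |Real.log (x / c)| ≤ Real.log x + |Real.log c| := by
    rw [Real.log_div hxpos.ne' hc.ne']
    calc |Real.log x - Real.log c| ≤ |Real.log x| + |Real.log c| := abs_sub _ _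
      _ = Real.log x + |Real.log c| := by rw [abs_of_nonneg hlogx0]
  have hmain : |x - y| ≤ D + δ' / 4 * x := by
    have h1 : |x - y| ≤ C + κ * |Real.log (x / c)| := by
      have h2 : x - y = (x - y - κ * Real.log (x / c)) + κ * Real.log (x / c) := by ring
      rw [h2]
      calc |(x - y - κ * Real.log (x / c)) + κ * Real.log (x / c)|
          ≤ |x - y - κ * Real.log (x / c)| + |κ * Real.log (x / c)| := abs_add_le _ _
        _ ≤ C + κ * |Real.log (x / c)| := by rw [abs_mul, abs_of_nonneg hκ]; linarith
    have h3 : κ * |Real.log (x / c)| ≤ κ * (Real.log t + x / t + |Real.log c|) :=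
      mul_le_mul_of_nonneg_left (habslog.trans (by linarith)) hκ
    have h4 : κ * (x / t) ≤ δ' / 4 * x := by
      rw [show κ * (x / t) = κ / t * x by ring]
      exact mul_le_mul_of_nonneg_right hκt hxpos.le
    have h5 : κ * (Real.log t + x / t + |Real.log c|) = κ * Real.log t + κ * (x / t) + κ * |Real.log c| := by ring
    linarith
  -- upper and lower linear bounds
  obtain ⟨hlo, hhi⟩ := abs_le.1 hmain
  -- `x (1 − δ'/4) ≤ y + D ≤ y (1 + δ'/4)` and `x (1 + δ'/4) ≥ y − D ≥ y (1 − δ'/4)`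
  have hup : x * (1 - δ' / 4) ≤ y * (1 + δ' / 4) := by nlinarith
  have hdn : y * (1 - δ' / 4) ≤ x * (1 + δ' / 4) := by nlinarith
  rw [abs_le]
  constructor
  · -- `x/y ≥ (1 − δ'/4)/(1 + δ'/4) ≥ 1 − δ'`
    rw [le_sub_iff_add_le, le_div_iff₀ hypos]
    nlinarith
  · rw [sub_le_iff_le_add, div_le_iff₀ hypos]
    nlinarith

/-- ★ §5 **`x_K · Λ³ → 1` deep in the window.**  Under the hypotheses of `flowJunction`, for every `δ > 0` there is `Y` (depending on
`M, m, R, b, δ` only — NOT on `K, β, L`) such that whenever the label `invRunningCoupling β L ≥ Y` (i.e. `Λ(β,L)³ ≤ 1/Y`), the endpoint satisfies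
`|x_K · luscherLambda β L ^ 3 − 1| ≤ δ`.  With (S2) of the RG plan this is everything the leading-order femto trace law asks of the FLOW module.
[cite: LuscherMunster1984, §2] [cite: Rivasseau1991, Lemma II.5.4] -/
theorem flowJunction_ratio {M m R : ℝ} {b : ℕ} (hM : 1 < M) (hm : 1 ≤ m) (hR0 : 0 ≤ R) {δ : ℝ} (hδ : 0 < δ) :
    ∃ Y : ℝ, 0 < Y ∧ ∀ (x e : ℕ → ℝ) (β : ℝ) (K L : ℕ),
      ∑ j ∈ Finset.range K, |e j| ≤ R →
      2 * b0 * Real.log M + (b1 / b0) * (2 * b0 * Real.log M) + R ≤ m / 2 →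
      (∀ j, j ≤ K → m ≤ x j) → x 0 = β / 2 →
      (∀ j, j < K → x j - x (j + 1) = 2 * b0 * Real.log M + (b1 / b0) * (2 * b0 * Real.log M) / x j + e j) →
      |Real.log (L : ℝ) - Real.log (b : ℝ) - K * Real.log M| ≤ 1 →
      Y ≤ invRunningCoupling β L → |x K * luscherLambda β L ^ 3 - 1| ≤ δ := by
  have hb0 : 0 < b0 := by unfold b0; positivity
  have hb1 : 0 < b1 := by unfold b1; positivity
  have hκ : 0 ≤ b1 / b0 := (div_pos hb1 hb0).le
  have hlogM : 0 < Real.log M := Real.log_pos hM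
  set C : ℝ := (b1 / b0) * (((b1 / b0) * (2 * b0 * Real.log M) + m ^ 2 / 2) * ((1 / m + 2 * R / m ^ 2) / (2 * b0 * Real.log M)) + R / m)
        + R + 2 * b0 * (|Real.log (b : ℝ)| + 1) with hC
  have hmpos : 0 < m := by linarith
  have hC0 : 0 ≤ C := by positivity
  obtain ⟨Y, hY, hYprop⟩ := ratio_near_one_of_abs_sub_le_log hκ hb0 hC0 hδ
  refine ⟨Y, hY, ?_⟩
  intro x e β K L hR hsmall hx hx0 hflow htower hYle
  have hj := flowJunction hM hm hR hsmall hx hx0 hflow htower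
  have hx1 : 1 ≤ x K := hm.trans (hx K le_rfl)
  have hv : 0 < invRunningCoupling β L := lt_of_lt_of_le hY hYle
  rw [BOHandover.luscherLambda_pow_three hv, ← div_eq_mul_inv]
  exact hYprop (x K) (invRunningCoupling β L) hx1 hYle hj

end TowerFlow

end Summit.QuantumFields.YangMills.Theorems.FemtoTransferGap.TwoLattice

end
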